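import Summits.ValiantsHypothesis.ValiantsHypothesis.Theorems.KPlusLogSqLawStaticPathSweep

/-!
# Route «KPlusLogSqLaw» — parametric max-weight independent set on a path: every event crossing is realised by a change of the optimum

HONEST FRAMING.  Helper toward the crux `WeakLifting` (item `stmt-ValiantsHypothesis-19561`, route `KPlusLogSqLaw`, cell `pub-symmetroid`,
seat val-sym-lift-p4 g8, 2026-08-27) on the line of its witness-plan stub `stub_tridiagonalSectorB` (tropical twin of the STATIC tridiagonal
sector = parametric maximum-weight independent set on a path = Eppstein's parametric closure problem on the fence, arXiv:1504.04073).
First the COUNTING COROLLARY of `…StaticPathSweep`: a chain of optimal sets at strictly increasing parameters with distinct prefix-sum values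
and consecutive sets distinct has at most as many steps as there are EVENT CROSSINGS strictly between its ends (`chain_le_card_eventCrossings`)
— the kernel form of the dual-plane count of LINEAR-LAW §2 (val-sym-lift-p4 g7, tools/dual.py).  Then the local converse: in general position, ACROSS EACH EVENT CROSSING THE OPTIMUM CHANGES — for an event crossing `τ` of the pair
`(p, q)` (at `τ`: `p` is the active index just below `q`, `q` a right record) and the two neighbouring cuts `c⁻ < τ < c⁺` (no other crossing
abscissa and no endpoint in between), the optima at the midpoints `(c⁻+τ)/2` and `(τ+c⁺)/2` differ (`ne_across_eventCrossing`); and between two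
parameters spanning NO event crossing the optimum does not change (`eq_of_no_eventCrossing`).  Together these say that
the number of changes of the optimal set along a generic sweep IS the number of event crossings (the dual count of LINEAR-LAW §2, tools/dual.py);
the packaging into one maximal chain (sorting the event abscissae) is left to the consumer.  Statements about a path DP; nothing here asserts
anything about `WeakLifting`, `TropicalB`, `KPlusLogSqLaw`, the stub in its window, `MatrixDescartes` (stmt-ValiantsHypothesis-18050) or `VP ≠ VNP`.
-/

set_option linter.dupNamespace false
set_option autoImplicit false

namespace Summit.ValiantsHypothesis.ValiantsHypothesis.Theorems.KPlusLogSqLaw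

open Finset Classical

namespace StaticPathFold

noncomputable section

/-! ## 0. Chains are no longer than the number of event crossings they span -/

section Count

variable (w₁ w₀ : ℕ → ℝ)

/-- **CHAINS OF OPTIMA ARE NO LONGER THAN THE NUMBER OF EVENT CROSSINGS THEY SPAN.** [folklore] -/
theorem chain_le_card_eventCrossings (i n N : ℕ) (θs : Fin (N + 1) → ℝ) (hθ : StrictMono θs) (Ms : Fin (N + 1) → Finset ℕ)
    (hgen : ∀ p q p' q', p < q → q ≤ n → p' < q' → q' ≤ n → (p ≠ p' ∨ q ≠ q') →
      altA (shift i w₁) p ≠ altA (shift i w₁) q → altA (shift i w₁) p' ≠ altA (shift i w₁) q' →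
      (altB (shift i w₀) q - altB (shift i w₀) p) / (altA (shift i w₁) p - altA (shift i w₁) q) ≠
        (altB (shift i w₀) q' - altB (shift i w₀) p') / (altA (shift i w₁) p' - altA (shift i w₁) q'))
    (hmem : ∀ k, Ms k ∈ indepSets i n)
    (hopt : ∀ k, ∑ t ∈ Ms k, W w₁ w₀ t (θs k) = opt w₁ w₀ i n (θs k))
    (hdis : ∀ k, ∀ p q, p ≤ n → q ≤ n → p ≠ q →
      L (altA (shift i w₁)) (altB (shift i w₀)) p (θs k) ≠ L (altA (shift i w₁)) (altB (shift i w₀)) q (θs k))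
    (hch : ∀ e : Fin N, Ms e.castSucc ≠ Ms e.succ) :
    N ≤ (((range (n + 1)) ×ˢ (range (n + 1))).filter (fun pq : ℕ × ℕ => pq.1 < pq.2 ∧
        altA (shift i w₁) pq.1 ≠ altA (shift i w₁) pq.2 ∧
        θs 0 < (altB (shift i w₀) pq.2 - altB (shift i w₀) pq.1) / (altA (shift i w₁) pq.1 - altA (shift i w₁) pq.2) ∧
        (altB (shift i w₀) pq.2 - altB (shift i w₀) pq.1) / (altA (shift i w₁) pq.1 - altA (shift i w₁) pq.2) < θs (Fin.last N) ∧
        lab (altA (shift i w₁)) (altB (shift i w₀)) (pq.2 - 1)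
            ((altB (shift i w₀) pq.2 - altB (shift i w₀) pq.1) / (altA (shift i w₁) pq.1 - altA (shift i w₁) pq.2)) = pq.1 ∧
        fold (altA (shift 0 (rev i n w₁))) (altB (shift 0 (rev i n w₀))) (n - pq.2)
            ((altB (shift i w₀) pq.2 - altB (shift i w₀) pq.1) / (altA (shift i w₁) pq.1 - altA (shift i w₁) pq.2)) =
          L (altA (shift 0 (rev i n w₁))) (altB (shift 0 (rev i n w₀))) (n - pq.2)
            ((altB (shift i w₀) pq.2 - altB (shift i w₀) pq.1) / (altA (shift i w₁) pq.1 - altA (shift i w₁) pq.2)))).card := by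
  set A := altA (shift i w₁) with hAdef
  set B := altB (shift i w₀) with hBdef
  set τ : ℕ × ℕ → ℝ := fun pq => (B pq.2 - B pq.1) / (A pq.1 - A pq.2) with hτ
  -- one event crossing inside each step
  have key : ∀ e : Fin N, ∃ pq : ℕ × ℕ, pq.1 < pq.2 ∧ pq.2 ≤ n ∧ A pq.1 ≠ A pq.2 ∧
      θs e.castSucc < τ pq ∧ τ pq < θs e.succ ∧
      lab A B (pq.2 - 1) (τ pq) = pq.1 ∧
      fold (altA (shift 0 (rev i n w₁))) (altB (shift 0 (rev i n w₀))) (n - pq.2) (τ pq) =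
        L (altA (shift 0 (rev i n w₁))) (altB (shift 0 (rev i n w₀))) (n - pq.2) (τ pq) := by
    intro e
    have hlt : θs e.castSucc < θs e.succ := hθ (Fin.castSucc_lt_succ)
    obtain ⟨p, q, hpq, hqn, hA, h1, h2, hl, hr⟩ :=
      exists_event_crossing w₁ w₀ (n := n) hgen (hdis e.succ) (hmem e.succ) (hopt e.succ) _ (θs e.castSucc) hlt
        (hdis e.castSucc) le_rfl (Ms e.castSucc) (hmem e.castSucc) (hopt e.castSucc) (hch e)
    exact ⟨(p, q), hpq, hqn, hA, h1, h2, hl, hr⟩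
  choose f hf using key
  -- distinct steps have disjoint parameter intervals, so `f` is injective
  have hinj : Function.Injective f := by
    intro e e' hee'
    by_contra hne
    obtain ⟨-, -, -, h1, h2, -, -⟩ := hf e
    obtain ⟨-, -, -, h1', h2', -, -⟩ := hf e'
    rw [hee'] at h1 h2
    rcases lt_or_gt_of_ne hne with hlt | hlt
    · have h3 : θs e.succ ≤ θs e'.castSucc :=
        hθ.monotone (Fin.le_iff_val_le_val.mpr (by rw [Fin.val_succ, Fin.val_castSucc]; exact hlt))
      linarith
    · have h3 : θs e'.succ ≤ θs e.castSucc :=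
        hθ.monotone (Fin.le_iff_val_le_val.mpr (by rw [Fin.val_succ, Fin.val_castSucc]; exact hlt))
      linarith
  -- and its image lies in the set of event crossings spanned by the chain
  have himg : ∀ e ∈ (univ : Finset (Fin N)), f e ∈ ((range (n + 1)) ×ˢ (range (n + 1))).filter (fun pq : ℕ × ℕ =>
      pq.1 < pq.2 ∧ A pq.1 ≠ A pq.2 ∧ θs 0 < τ pq ∧ τ pq < θs (Fin.last N) ∧
      lab A B (pq.2 - 1) (τ pq) = pq.1 ∧
      fold (altA (shift 0 (rev i n w₁))) (altB (shift 0 (rev i n w₀))) (n - pq.2) (τ pq) =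
        L (altA (shift 0 (rev i n w₁))) (altB (shift 0 (rev i n w₀))) (n - pq.2) (τ pq)) := by
    intro e _
    obtain ⟨hpq, hqn, hA, h1, h2, hl, hr⟩ := hf e
    rw [mem_filter, mem_product, mem_range, mem_range]
    have h0 : θs 0 ≤ θs e.castSucc := hθ.monotone (Fin.zero_le _)
    have hN : θs e.succ ≤ θs (Fin.last N) := hθ.monotone (Fin.le_last _)
    exact ⟨⟨by omega, by omega⟩, hpq, hA, lt_of_le_of_lt h0 h1, lt_of_lt_of_le h2 hN, hl, hr⟩
  have hcard := card_le_card_of_injOn f himg (fun e _ e' _ h => hinj h)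
  rwa [card_univ, Fintype.card_fin] at hcard

end Count

/-! ## 1. Two more facts about a pair of lines -/

/-- the difference of two non-parallel lines in crossing form. [folklore] -/
theorem L_sub_eq_mul (a b : ℕ → ℝ) {p q : ℕ} (hA : a p ≠ a q) (t : ℝ) :
    L a b p t - L a b q t = (a p - a q) * (t - (b q - b p) / (a p - a q)) := by
  have hA' : a p - a q ≠ 0 := sub_ne_zero.mpr hA
  unfold L
  field_simp
  ring

/-- non-parallel lines meet only at their crossing abscissa. [folklore] -/
theorem eq_crossing_of_L_eq (a b : ℕ → ℝ) {p q : ℕ} (hA : a p ≠ a q) {t : ℝ} (h : L a b p t = L a b q t) :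
    t = (b q - b p) / (a p - a q) := by
  have h2 := L_sub_eq_mul a b hA t
  rw [h, sub_self] at h2
  have h3 := (mul_eq_zero.mp h2.symm).resolve_left (sub_ne_zero.mpr hA)
  linarith

/-- across their crossing abscissa two non-parallel lines change order. [folklore] -/
theorem L_lt_flip_of_mem (a b : ℕ → ℝ) {p q : ℕ} (hA : a p ≠ a q) {t t' : ℝ}
    (h1 : t < (b q - b p) / (a p - a q)) (h2 : (b q - b p) / (a p - a q) < t') :
    L a b p t < L a b q t ↔ ¬ L a b p t' < L a b q t' := by
  rw [L_lt_iff_sign a b hA t, L_lt_iff_sign a b hA t']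
  set τ := (b q - b p) / (a p - a q)
  have hu : a p - a q ≠ 0 := sub_ne_zero.mpr hA
  rcases hu.lt_or_gt with hu | hu
  · constructor
    · intro _ h'; nlinarith
    · intro _; nlinarith
  · constructor
    · intro h _; nlinarith
    · intro h; by_contra h'; apply h; nlinarith

variable (w₁ w₀ : ℕ → ℝ)

/-- **distinct values off the crossings**: if parallel prefix-sum lines are distinct lines and no non-parallel pair crosses at `t`, the prefix-sum
lines take pairwise distinct values at `t`. [folklore] -/
theorem distinct_of_no_crossing_at {i n : ℕ} {t : ℝ}
    (hpar : ∀ p q, p < q → q ≤ n → altA (shift i w₁) p = altA (shift i w₁) q → altB (shift i w₀) p ≠ altB (shift i w₀) q)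
    (hnc : ∀ p q, p < q → q ≤ n → altA (shift i w₁) p ≠ altA (shift i w₁) q →
      (altB (shift i w₀) q - altB (shift i w₀) p) / (altA (shift i w₁) p - altA (shift i w₁) q) ≠ t) :
    ∀ p q, p ≤ n → q ≤ n → p ≠ q → L (altA (shift i w₁)) (altB (shift i w₀)) p t ≠ L (altA (shift i w₁)) (altB (shift i w₀)) q t := by
  have key : ∀ p q, p < q → q ≤ n → L (altA (shift i w₁)) (altB (shift i w₀)) p t ≠ L (altA (shift i w₁)) (altB (shift i w₀)) q t := by
    intro p q hpq hqn heq
    by_cases hA : altA (shift i w₁) p = altA (shift i w₁) q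
    · apply hpar p q hpq hqn hA
      unfold L at heq
      rw [hA] at heq
      linarith
    · exact hnc p q hpq hqn hA (eq_crossing_of_L_eq _ _ hA heq).symm
  intro p q hp hq hpq
  rcases lt_or_gt_of_ne hpq with h | h
  · exact key p q h hq
  · exact (key q p h hp).symm

/-! ## 2. No event crossing spanned ⇒ no change -/

/-- **between two parameters spanning NO event crossing the optimum does not change** (contrapositive packaging of `exists_event_crossing`).
[folklore] -/
theorem eq_of_no_eventCrossing {i n : ℕ} {θ θ' : ℝ} (hθ : θ < θ')
    (hgen : ∀ p q p' q', p < q → q ≤ n → p' < q' → q' ≤ n → (p ≠ p' ∨ q ≠ q') →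
      altA (shift i w₁) p ≠ altA (shift i w₁) q → altA (shift i w₁) p' ≠ altA (shift i w₁) q' →
      (altB (shift i w₀) q - altB (shift i w₀) p) / (altA (shift i w₁) p - altA (shift i w₁) q) ≠
        (altB (shift i w₀) q' - altB (shift i w₀) p') / (altA (shift i w₁) p' - altA (shift i w₁) q'))
    (hdis : ∀ p q, p ≤ n → q ≤ n → p ≠ q →
      L (altA (shift i w₁)) (altB (shift i w₀)) p θ ≠ L (altA (shift i w₁)) (altB (shift i w₀)) q θ)
    (hdis' : ∀ p q, p ≤ n → q ≤ n → p ≠ q →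
      L (altA (shift i w₁)) (altB (shift i w₀)) p θ' ≠ L (altA (shift i w₁)) (altB (shift i w₀)) q θ')
    (hnoev : ∀ p q, p < q → q ≤ n → altA (shift i w₁) p ≠ altA (shift i w₁) q →
      θ < (altB (shift i w₀) q - altB (shift i w₀) p) / (altA (shift i w₁) p - altA (shift i w₁) q) →
      (altB (shift i w₀) q - altB (shift i w₀) p) / (altA (shift i w₁) p - altA (shift i w₁) q) < θ' →
      ¬ (lab (altA (shift i w₁)) (altB (shift i w₀)) (q - 1)
            ((altB (shift i w₀) q - altB (shift i w₀) p) / (altA (shift i w₁) p - altA (shift i w₁) q)) = p ∧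
          fold (altA (shift 0 (rev i n w₁))) (altB (shift 0 (rev i n w₀))) (n - q)
              ((altB (shift i w₀) q - altB (shift i w₀) p) / (altA (shift i w₁) p - altA (shift i w₁) q)) =
            L (altA (shift 0 (rev i n w₁))) (altB (shift 0 (rev i n w₀))) (n - q)
              ((altB (shift i w₀) q - altB (shift i w₀) p) / (altA (shift i w₁) p - altA (shift i w₁) q))))
    {M M' : Finset ℕ} (hM : M ∈ indepSets i n) (hM' : M' ∈ indepSets i n)
    (hopt : ∑ t ∈ M, W w₁ w₀ t θ = opt w₁ w₀ i n θ) (hopt' : ∑ t ∈ M', W w₁ w₀ t θ' = opt w₁ w₀ i n θ') : M = M' := by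
  by_contra hne
  obtain ⟨p, q, hpq, hqn, hA, h1, h2, hl, hr⟩ :=
    exists_event_crossing w₁ w₀ (n := n) hgen hdis' hM' hopt' _ θ hθ hdis le_rfl M hM hopt hne
  exact hnoev p q hpq hqn hA h1 h2 ⟨hl, hr⟩

/-! ## 3. Each event crossing is realised -/

/-- **ACROSS AN EVENT CROSSING THE OPTIMUM CHANGES.**  `(α, κ)` a non-parallel pair with crossing abscissa `τ`; cuts `c⁻ < τ < c⁺` such
that every OTHER non-parallel pair's crossing abscissa is `≤ c⁻` or `≥ c⁺`; parallel pairs of prefix-sum lines are distinct lines.  If at `τ` the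
active index just below `κ` is `α` and `κ` is a right record (the event test read at the crossing), then the optima at the midpoints
`u = (c⁻+τ)/2` and `s = (τ+c⁺)/2` differ. [folklore] -/
theorem ne_across_eventCrossing {i n α κ : ℕ} (hακ : α < κ) (hκn : κ ≤ n) (hA : altA (shift i w₁) α ≠ altA (shift i w₁) κ)
    {cm cp : ℝ}
    (hcm : cm < (altB (shift i w₀) κ - altB (shift i w₀) α) / (altA (shift i w₁) α - altA (shift i w₁) κ))
    (hcp : (altB (shift i w₀) κ - altB (shift i w₀) α) / (altA (shift i w₁) α - altA (shift i w₁) κ) < cp)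
    (hpar : ∀ p q, p < q → q ≤ n → altA (shift i w₁) p = altA (shift i w₁) q → altB (shift i w₀) p ≠ altB (shift i w₀) q)
    (hcut : ∀ p q, p < q → q ≤ n → altA (shift i w₁) p ≠ altA (shift i w₁) q → (p ≠ α ∨ q ≠ κ) →
      (altB (shift i w₀) q - altB (shift i w₀) p) / (altA (shift i w₁) p - altA (shift i w₁) q) ≤ cm ∨
        cp ≤ (altB (shift i w₀) q - altB (shift i w₀) p) / (altA (shift i w₁) p - altA (shift i w₁) q))
    (hev : lab (altA (shift i w₁)) (altB (shift i w₀)) (κ - 1)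
        ((altB (shift i w₀) κ - altB (shift i w₀) α) / (altA (shift i w₁) α - altA (shift i w₁) κ)) = α ∧
      fold (altA (shift 0 (rev i n w₁))) (altB (shift 0 (rev i n w₀))) (n - κ)
          ((altB (shift i w₀) κ - altB (shift i w₀) α) / (altA (shift i w₁) α - altA (shift i w₁) κ)) =
        L (altA (shift 0 (rev i n w₁))) (altB (shift 0 (rev i n w₀))) (n - κ)
          ((altB (shift i w₀) κ - altB (shift i w₀) α) / (altA (shift i w₁) α - altA (shift i w₁) κ)))
    {Mu Ms : Finset ℕ} (hMu : Mu ∈ indepSets i n) (hMs : Ms ∈ indepSets i n)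
    (hoptu : ∑ t ∈ Mu, W w₁ w₀ t ((cm + (altB (shift i w₀) κ - altB (shift i w₀) α) / (altA (shift i w₁) α - altA (shift i w₁) κ)) / 2) =
      opt w₁ w₀ i n ((cm + (altB (shift i w₀) κ - altB (shift i w₀) α) / (altA (shift i w₁) α - altA (shift i w₁) κ)) / 2))
    (hopts : ∑ t ∈ Ms, W w₁ w₀ t (((altB (shift i w₀) κ - altB (shift i w₀) α) / (altA (shift i w₁) α - altA (shift i w₁) κ) + cp) / 2) =
      opt w₁ w₀ i n (((altB (shift i w₀) κ - altB (shift i w₀) α) / (altA (shift i w₁) α - altA (shift i w₁) κ) + cp) / 2)) :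
    Mu ≠ Ms := by
  set A := altA (shift i w₁) with hAdef
  set B := altB (shift i w₀) with hBdef
  set τ := (B κ - B α) / (A α - A κ) with hτ
  set u := (cm + τ) / 2 with hu
  set s := (τ + cp) / 2 with hs
  have hαn : α ≤ n := hακ.le.trans hκn
  have hu1 : cm < u := by rw [hu]; linarith
  have hu2 : u < τ := by rw [hu]; linarith
  have hs1 : τ < s := by rw [hs]; linarith
  have hs2 : s < cp := by rw [hs]; linarith
  -- other pairs keep their order on `[u, s]` and on `[u, τ]`; crossing abscissae symmetric in the pair
  have hkeep : ∀ (t : ℝ), u ≤ t → t ≤ s → ∀ p q, p ≤ n → q ≤ n → ¬(p = α ∧ q = κ) → ¬(p = κ ∧ q = α) →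
      (L A B p u < L A B q u ↔ L A B p t < L A B q t) := by
    intro t hut hts p q hp hq h1 h2
    by_cases hApq : A p = A q
    · exact L_lt_iff_of_parallel A B hApq u t
    rcases lt_trichotomy p q with hpq | rfl | hpq
    · rcases hcut p q hpq hq hApq (by by_contra hh; push Not at hh; exact h1 hh) with h | h
      · exact L_lt_iff_of_notMem A B hApq hut (Or.inl (lt_of_le_of_lt h hu1))
      · exact L_lt_iff_of_notMem A B hApq hut (Or.inr (lt_of_lt_of_le (lt_of_le_of_lt hts hs2) h))
    · exact absurd rfl hApq
    · rcases hcut q p hpq hp (Ne.symm hApq) (by by_contra hh; push Not at hh; exact h2 ⟨hh.2, hh.1⟩) with h | h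
      · rw [crossing_symm A B] at h
        exact L_lt_iff_of_notMem A B hApq hut (Or.inl (lt_of_le_of_lt h hu1))
      · rw [crossing_symm A B] at h
        exact L_lt_iff_of_notMem A B hApq hut (Or.inr (lt_of_lt_of_le (lt_of_le_of_lt hts hs2) h))
  -- distinct values at `u` and at `s`
  have hnc : ∀ (t : ℝ), cm < t → t < cp → t ≠ τ → ∀ p q, p < q → q ≤ n → A p ≠ A q → (B q - B p) / (A p - A q) ≠ t := by
    intro t ht1 ht2 htτ p q hpq hqn hApq he
    by_cases hpqακ : p = α ∧ q = κ
    · obtain ⟨rfl, rfl⟩ := hpqακ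
      exact htτ he.symm
    · rcases hcut p q hpq hqn hApq (by by_contra hh; push Not at hh; exact hpqακ hh) with h | h
      · linarith
      · linarith
  have hdisu := distinct_of_no_crossing_at w₁ w₀ (n := n) hpar (hnc u hu1 (hu2.trans (hs1.trans hs2)) (ne_of_lt hu2))
  have hdiss := distinct_of_no_crossing_at w₁ w₀ (n := n) hpar (hnc s (hu1.trans (hu2.trans hs1)) hs2 (ne_of_gt hs1))
  -- adjacency at `u`: compare at `τ`, where `S α = S κ`
  have hadj : ∀ x, x ≤ n → x ≠ α → x ≠ κ → (L A B x u < L A B α u ↔ L A B x u < L A B κ u) := by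
    intro x hx hxα hxκ
    have e1 := hkeep τ hu2.le hs1.le x α hx hαn (fun h => hxα h.1) (fun h => hxκ h.1)
    have e2 := hkeep τ hu2.le hs1.le x κ hx hκn (fun h => hxα h.1) (fun h => hxκ h.1)
    rw [e1, e2, show L A B α τ = L A B κ τ from L_eq_at_crossing A B hA]
  -- the event conditions, moved from `τ` to `u`
  have hevu := (event_iff_of_order w₁ w₀ hακ hκn (θ := u) (τ := τ)
    (fun p q hp hq h1 h2 => hkeep τ hu2.le hs1.le p q hp hq h1 h2)).mpr hev
  have hLM := (lab_pred_eq_iff A B hακ u).mp hevu.1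
  -- the pair flips between `u` and `s`
  have hflip : L A B α u < L A B κ u ↔ ¬ L A B α s < L A B κ s := L_lt_flip_of_mem A B hA hu2 hs1
  exact (ne_iff_event w₁ w₀ hακ hκn hMu hMs (unique_of_distinct w₁ w₀ hdisu hMu hoptu) (unique_of_distinct w₁ w₀ hdiss hMs hopts)
    (fun p q hp hq h1 h2 => hkeep s (hu2.trans hs1).le le_rfl p q hp hq h1 h2) hdisu hdiss hadj).mpr ⟨hflip, hLM.1, hLM.2, hevu.2⟩

end

end StaticPathFold

end Summit.ValiantsHypothesis.ValiantsHypothesis.Theorems.KPlusLogSqLaw
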